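import Summits.QuantumAdvantage.AdviceFreeQNC0.BlockFibre37Blocks
import HarnessLib

/-!
# Cell qa-qnc0 — P-37c (c1): the BLOCK-FIBRE LAW, proved
# (planner qa-qnc0-p1 gen 37; target `BlockFibre37.BlockFibreLaw` of exp36/BlockFibre37.lean, verbatim definitions)

On the fibre `{blockExt B a v : v ∈ {0,1}^m}` of a background `a` over a family `B` of `m` admissible blocks of walk
bits, a walk strategy whose cut tables have `𝔽₂`-degree `≤ D` in the fibre parameter `v`, with `D + 1 ≤ √m` and
`m ≥ m₀`, wins the `p = 3` ring/walk game on at most `(1 − c₀)·2^m` points of the fibre (`c₀, m₀` the constants of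
`AffBells22.failSet_ge_of_mem_fullSpan`).  Hence `blockFibreLaw : BlockFibreLaw`.

## Proof (no virtual bells, no `walkHardGenSqrt`; one degree is the whole price)

1. NORMALISATION.  Re-parametrise the fibre by `v = w ⊕ π`, `π_j = [bwt_j ≡ 2]`: the new background
   `a' = blockExt B a π` has every block weight `bwt ≡ 1 (mod 3)`, the same fibre, the same win count and the same
   degree hypothesis (`comp_mem_lowDeg_of_coord`).
2. ADDITIVE SPLIT (mod 3).  With `[a ⊕ e] ≡ [a] + e·(1 + [a])`,
   `walkExp (blockExt B a w) g ≡ walkExp a g + Σ_j [w_j]·μ_{g,j}`, `μ_{g,j} = Σ_{i ∈ block j} (1+[i<g])(1+[a_i])`.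
   For a normalised block not straddled by `g`, `μ_{g,j} ≡ 1 + [block j lies before g]`, and the blocks before `g`
   form the initial segment `j < h_g`; so `Σ_j [w_j] μ_{g,j} ≡ walkExp w h_g + δ_g(w)` where `δ_g(w) = [w_{j₀}](μ_{g,j₀}+2)`
   for the (unique, `= h_g`) block `j₀` straddled by `g`, and `δ_g = 0` if there is none.
3. MODULE.  `ω^{walkExp (blockExt a w) g} = ω^{walkExp a g} · ω^{δ_g(w)} · χ_{aPat h_g}(w)` and
   `ιF(Y_g w)·ω^{δ_g(w)} = ιF(Y_g w ∧ ¬w_{j₀}) + ρ·ιF(Y_g w ∧ w_{j₀}) ∈ polySpan m (D+1)`; hence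
   `w ↦ stratFun c y (blockExt B a w) ∈ fullSpan m (D+1)` (`polySpan_mul_chi_mem`, `Submodule.sum_mem`).
4. COUNT.  `tr ∘ stratFun = ιF ∘ WIN`, so `#WIN + #FAIL = 2^m` and `failSet_ge_of_mem_fullSpan` gives the law.

(Part 2/2.) Cell qa-qnc0, crux stmt-QuantumAdvantage-22907.  AUTHORED AND PROVED BY THE PLANNER qa-qnc0-p1 gen 37 (P-37c (c1), INBOX P1-37c 14:53Z, evidence #58/#60 on stmt-22907, file `HOME/qa-qnc0-p1/exp37/BlockFibreLaw37.lean`, 596 lines, sha bb88df9c8e7f5626, rc 0 / 0 sorries); landed verbatim by qn-prover-3 g21 as a two-way split: `BlockFibre37Blocks` (§§0–2: typed targets `BlockFam`/`InBlock`/`bwt`/`Admissible`/`blockExt`/`BlockFibreLaw`, blocks, the walk exponent on the fibre mod 3) → `BlockFibreLaw37` (§§3–5: module membership, counting, normalisation, `blockFibreLaw : BlockFibreLaw`).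
-/

noncomputable section

open Classical

namespace Summit.QuantumAdvantage.AdviceFreeQNC0

open Finset
open Literature.Computability.MetaComplexity Literature.Computability.MetaComplexity.Smolensky
open F4 AffBells22 Subcube

namespace BlockFibre37

variable {n m : ℕ}

/-! ### 3. The strategy's `𝔽₄`-function on the fibre lies in `fullSpan m (D+1)` -/

/-- `ω^{walkExp (blockExt a w) g} = ω^{walkExp a g} · ω^{δ_g(w)} · χ_{aPat h_g}(w)` (normalised background). -/
theorem omega_pow_walkExp_blockExt (B : BlockFam n m) (a : Fin n → Bool) (ha : ∀ j, bwt B a j % 3 = 1)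
    (w : Fin m → Bool) (g : ℕ) :
    ω ^ walkExp (blockExt B a w) g = ω ^ walkExp a g * ω ^ delta B a g w * chi (aPat (hIdx B g)) w := by
  have hmod : walkExp (blockExt B a w) g % 3 = (walkExp a g + delta B a g w + walkExp w (hIdx B g)) % 3 := by
    rw [walkExp_blockExt_mod, Nat.add_mod, sum_mu_mod B a ha g w, ← Nat.add_mod]
    omega
  rw [omega_pow_mod, hmod, ← omega_pow_mod, pow_add, pow_add, omega_pow_walkExp w (hIdx B g)]

/-- the indicator of a coordinate has degree `1`. -/
theorem ind_coord_mem (j : Fin m) :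
    (fun w : Fin m → Bool => if w j = true then (1 : ZMod 2) else 0) ∈ lowDeg (ZMod 2) m 1 := by
  have e : (fun w : Fin m → Bool => if w j = true then (1 : ZMod 2) else 0) = mono (ZMod 2) {j} := by
    funext w; rw [mono_apply]; simp
  rw [e]; exact mono_mem_lowDeg (by simp)

/-- the indicator of a negated coordinate has degree `1`. -/
theorem ind_not_coord_mem (j : Fin m) :
    (fun w : Fin m → Bool => if (!w j) = true then (1 : ZMod 2) else 0) ∈ lowDeg (ZMod 2) m 1 := by
  have e : (fun w : Fin m → Bool => if (!w j) = true then (1 : ZMod 2) else 0) = 1 - mono (ZMod 2) {j} := by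
    funext w
    rw [Pi.sub_apply, Pi.one_apply, mono_apply]
    simp only [Finset.mem_singleton, forall_eq]
    cases w j <;> simp
  rw [e]
  exact Submodule.sub_mem _ (by rw [← mono_empty]; exact mono_mem_lowDeg (by simp)) (mono_mem_lowDeg (by simp))

/-- a coordinate has degree `1`. -/
theorem hasDeg_coordB (j : Fin m) : HasDeg (fun w : Fin m → Bool => w j) 1 := ind_coord_mem j

/-- the twisted table `ιF(Y w)·ω^{δ_g(w)}` is an `𝔽₄`-combination of monomials of degree `≤ D + 1`. -/
theorem iotaF_mul_delta_mem (B : BlockFam n m) (a : Fin n → Bool) (g : ℕ) {D : ℕ} {Y : (Fin m → Bool) → Bool}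
    (hY : HasDeg Y D) : (fun w => ιF (Y w) * ω ^ delta B a g w) ∈ polySpan m (D + 1) := by
  by_cases hS : ∃ j, Strad B g j
  · obtain ⟨j₀, hj₀⟩ := hS
    have e : (fun w => ιF (Y w) * ω ^ delta B a g w)
        = (fun w => ιF (Y w && !w j₀)) + (ω ^ (mu B a g j₀ + 2)) • (fun w => ιF (Y w && w j₀)) := by
      funext w
      simp only [Pi.add_apply, Pi.smul_apply, smul_eq_mul]
      rw [delta_of_strad B a hj₀]
      unfold ιF
      cases Y w <;> cases w j₀ <;> simp
    rw [e]
    exact Submodule.add_mem _ (iotaF_mem_polySpan (hasDeg_and_not hY (hasDeg_coordB j₀)))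
      (Submodule.smul_mem _ _ (iotaF_mem_polySpan (hasDeg_and hY (hasDeg_coordB j₀))))
  · have e : (fun w => ιF (Y w) * ω ^ delta B a g w) = fun w => ιF (Y w) := by
      funext w; rw [delta_of_not_exists B a hS, pow_zero, mul_one]
    rw [e]
    exact iotaF_mem_polySpan (hasDeg_of_le hY (Nat.le_succ D))

/-- **module step**: on a normalised block fibre the strategy's `𝔽₄`-function lies in `fullSpan m (D+1)`. -/
theorem stratFun_blockExt_mem (B : BlockFam n m) (a : Fin n → Bool) (ha : ∀ j, bwt B a j % 3 = 1) (c : ℕ)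
    (y : Fin (n + 1) → (Fin n → Bool) → Bool) {D : ℕ} (hy : ∀ g, HasDeg (fun v => y g (blockExt B a v)) D) :
    (fun w => stratFun c y (blockExt B a w)) ∈ fullSpan m (D + 1) := by
  have e : (fun w => stratFun c y (blockExt B a w)) = ∑ g : Fin (n + 1),
      ((ω ^ (c + g.val) * ω ^ walkExp a g.val) •
        fun w => (ιF (y g (blockExt B a w)) * ω ^ delta B a g.val w) * chi (aPat (hIdx B g.val)) w) := by
    funext w
    unfold stratFun
    simp only [Finset.sum_apply, Pi.smul_apply, smul_eq_mul]
    refine sum_congr rfl fun g _ => ?_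
    rw [pow_add, omega_pow_walkExp_blockExt B a ha w g.val]
    ring
  rw [e]
  exact Submodule.sum_mem _ fun g _ =>
    Submodule.smul_mem _ _ (polySpan_mul_chi_mem (iotaF_mul_delta_mem B a g.val (hy g)) (hIdx B g.val))

/-! ### 4. Counting on a normalised fibre -/

/-- `#WIN + #FAIL = 2^m` on the fibre. -/
theorem card_win_add_card_fail (B : BlockFam n m) (a : Fin n → Bool) (c : ℕ)
    (y : Fin (n + 1) → (Fin n → Bool) → Bool) :
    (univ.filter fun w : Fin m → Bool => ringWinU c y (blockExt B a w) = true).card +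
      (failSetOf (fun w => stratFun c y (blockExt B a w))).card = 2 ^ m := by
  haveI := F4.nontrivial
  have e : failSetOf (fun w => stratFun c y (blockExt B a w)) =
      univ.filter fun w : Fin m → Bool => ¬ ringWinU c y (blockExt B a w) = true := by
    unfold failSetOf
    refine filter_congr fun w _ => ?_
    rw [tr_stratFun]
    unfold ιF
    cases ringWinU c y (blockExt B a w) <;> simp
  rw [e, card_filter_add_card_filter_not, card_univ, Fintype.card_fun, Fintype.card_bool, Fintype.card_fin]

/-- **the law on a normalised fibre.** -/
theorem card_win_blockExt_le_norm {c₀ : ℝ} {m₀ : ℕ}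
    (hcore : ∀ m ≥ m₀, ∀ D : ℕ, D ≤ Nat.sqrt m →
      ∀ f : (Fin m → Bool) → F4, f ∈ fullSpan m D → c₀ * (2 : ℝ) ^ m ≤ ((failSetOf f).card : ℝ))
    (B : BlockFam n m) (hm : m₀ ≤ m) (a : Fin n → Bool) (ha : ∀ j, bwt B a j % 3 = 1) {D : ℕ}
    (hD : D + 1 ≤ Nat.sqrt m) (c : ℕ) (y : Fin (n + 1) → (Fin n → Bool) → Bool)
    (hy : ∀ g, HasDeg (fun v => y g (blockExt B a v)) D) :
    ((univ.filter fun w : Fin m → Bool => ringWinU c y (blockExt B a w) = true).card : ℝ)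
      ≤ (1 - c₀) * (2 : ℝ) ^ m := by
  have h1 := hcore m hm (D + 1) hD _ (stratFun_blockExt_mem B a ha c y hy)
  have h2 := card_win_add_card_fail B a c y
  have h2R : ((univ.filter fun w : Fin m → Bool => ringWinU c y (blockExt B a w) = true).card : ℝ)
      + ((failSetOf (fun w => stratFun c y (blockExt B a w))).card : ℝ) = (2 : ℝ) ^ m := by
    exact_mod_cast h2
  linarith

/-! ### 5. Normalisation and the law -/

/-- coordinatewise xor of fibre parameters. -/
def xorV (w π : Fin m → Bool) : Fin m → Bool := fun j => xor (w j) (π j)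

/-- `xorV · π` is an involution. -/
theorem xorV_xorV (w π : Fin m → Bool) : xorV (xorV w π) π = w := by
  funext j; unfold xorV; cases w j <;> cases π j <;> rfl

/-- re-parametrisation of the fibre: `blockExt (blockExt a π) w = blockExt a (w ⊕ π)`. -/
theorem blockExt_blockExt (B : BlockFam n m) (a : Fin n → Bool) (π w : Fin m → Bool) :
    blockExt B (blockExt B a π) w = blockExt B a (xorV w π) := by
  funext i
  by_cases h : ∃ j, InBlock B j i
  · obtain ⟨j, hj⟩ := h
    rw [blockExt_of_inBlock B _ w hj, blockExt_of_inBlock B a π hj, blockExt_of_inBlock B a _ hj]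
    unfold xorV
    cases a i <;> cases π j <;> cases w j <;> rfl
  · push Not at h
    rw [blockExt_of_not_inBlock B _ w h, blockExt_of_not_inBlock B a π h, blockExt_of_not_inBlock B a _ h]

/-- the normalising parameter: complement the blocks with `bwt ≡ 2`. -/
def normP (B : BlockFam n m) (a : Fin n → Bool) : Fin m → Bool := fun j => decide (bwt B a j % 3 = 2)

/-- A block whose fibre bit is `false` keeps its block weight. -/
theorem bwt_blockExt_of_false (B : BlockFam n m) (a : Fin n → Bool) (π : Fin m → Bool) {j : Fin m}
    (h : π j = false) : bwt B (blockExt B a π) j = bwt B a j := by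
  unfold bwt
  have e : (univ.filter fun i : Fin n => InBlock B j i ∧ blockExt B a π i = true)
      = univ.filter fun i : Fin n => InBlock B j i ∧ a i = true := by
    ext i
    simp only [mem_filter, mem_univ, true_and]
    constructor
    · rintro ⟨hj, hv⟩
      rw [blockExt_of_inBlock B a π hj, h, Bool.xor_false] at hv
      exact ⟨hj, hv⟩
    · rintro ⟨hj, hv⟩
      refine ⟨hj, ?_⟩
      rw [blockExt_of_inBlock B a π hj, h, Bool.xor_false]
      exact hv
  rw [e]

/-- Complementing block `j` replaces its block weight `b` by `3·len − b`. -/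
theorem bwt_blockExt_of_true (B : BlockFam n m) (a : Fin n → Bool) (π : Fin m → Bool) {j : Fin m}
    (h : π j = true) : bwt B (blockExt B a π) j + bwt B a j = 3 * B.len j := by
  unfold bwt
  have e1 : (univ.filter fun i : Fin n => InBlock B j i ∧ blockExt B a π i = true)
      = (blk B j).filter fun i => ¬ (a i = true) := by
    ext i
    unfold blk
    simp only [mem_filter, mem_univ, true_and]
    constructor
    · rintro ⟨hj, hv⟩
      rw [blockExt_of_inBlock B a π hj, h, Bool.xor_true] at hv
      refine ⟨hj, ?_⟩
      cases ha : a i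
      · exact Bool.false_ne_true
      · rw [ha] at hv; exact absurd hv (by decide)
    · rintro ⟨hj, hv⟩
      refine ⟨hj, ?_⟩
      rw [blockExt_of_inBlock B a π hj, h, Bool.xor_true]
      cases ha : a i
      · rfl
      · exact absurd ha hv
  have e2 : (univ.filter fun i : Fin n => InBlock B j i ∧ a i = true) = (blk B j).filter fun i => a i = true := by
    unfold blk; rw [filter_filter]
  rw [e1, e2]
  have h3 := Finset.card_filter_add_card_filter_not (s := blk B j) (fun i => a i = true)
  rw [card_blk] at h3
  omega

/-- the normalised background has every block weight `≡ 1 (mod 3)`. -/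
theorem bwt_norm (B : BlockFam n m) (a : Fin n → Bool) (hadm : ∀ j, Admissible B a j) (j : Fin m) :
    bwt B (blockExt B a (normP B a)) j % 3 = 1 := by
  by_cases h : bwt B a j % 3 = 2
  · have hπ : normP B a j = true := by unfold normP; rw [decide_eq_true h]
    have := bwt_blockExt_of_true B a _ hπ
    omega
  · have hπ : normP B a j = false := by unfold normP; rw [decide_eq_false h]
    rw [bwt_blockExt_of_false B a _ hπ]
    have := hadm j
    unfold Admissible at this
    omega

/-- degree hypotheses survive the re-parametrisation `w ↦ w ⊕ π`. -/
theorem hasDeg_comp_xorV (π : Fin m → Bool) {D : ℕ} {Y : (Fin m → Bool) → Bool} (hY : HasDeg Y D) :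
    HasDeg (fun w => Y (xorV w π)) D := by
  unfold HasDeg at *
  refine comp_mem_lowDeg_of_coord (F := ZMod 2) (fun w => xorV w π) (fun j => ?_) hY
  unfold xorV
  cases π j
  · simp only [Bool.xor_false]; exact ind_coord_mem j
  · simp only [Bool.xor_true]; exact ind_not_coord_mem j

/-- counts survive the re-parametrisation `w ↦ w ⊕ π`. -/
theorem card_filter_xorV (π : Fin m → Bool) (P : (Fin m → Bool) → Prop) [DecidablePred P] :
    (univ.filter fun w => P (xorV w π)).card = (univ.filter fun v => P v).card := by
  refine card_bij (fun w _ => xorV w π) ?_ ?_ ?_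
  · intro w hw
    rw [mem_filter] at hw ⊢
    exact ⟨mem_univ _, hw.2⟩
  · intro w₁ _ w₂ _ h
    rw [← xorV_xorV w₁ π, h, xorV_xorV]
  · intro v hv
    refine ⟨xorV v π, ?_, xorV_xorV v π⟩
    rw [mem_filter] at hv ⊢
    refine ⟨mem_univ _, ?_⟩
    rw [xorV_xorV]
    exact hv.2

/-- **the block-fibre law with constants**: `#WIN ≤ (1 − c₀)·2^m` on every admissible block fibre. -/
theorem card_win_blockExt_le {c₀ : ℝ} {m₀ : ℕ}
    (hcore : ∀ m ≥ m₀, ∀ D : ℕ, D ≤ Nat.sqrt m →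
      ∀ f : (Fin m → Bool) → F4, f ∈ fullSpan m D → c₀ * (2 : ℝ) ^ m ≤ ((failSetOf f).card : ℝ))
    (B : BlockFam n m) (hm : m₀ ≤ m) (a : Fin n → Bool) (hadm : ∀ j, Admissible B a j) {D : ℕ}
    (hD : D + 1 ≤ Nat.sqrt m) (c : ℕ) (y : Fin (n + 1) → (Fin n → Bool) → Bool)
    (hy : ∀ g, HasDeg (fun v => y g (blockExt B a v)) D) :
    ((univ.filter fun v : Fin m → Bool => ringWinU c y (blockExt B a v) = true).card : ℝ)
      ≤ (1 - c₀) * (2 : ℝ) ^ m := by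
  have hn : ∀ j, bwt B (blockExt B a (normP B a)) j % 3 = 1 := bwt_norm B a hadm
  have hy' : ∀ g, HasDeg (fun w => y g (blockExt B (blockExt B a (normP B a)) w)) D := by
    intro g
    have e : (fun w => y g (blockExt B (blockExt B a (normP B a)) w))
        = fun w => y g (blockExt B a (xorV w (normP B a))) := by
      funext w; rw [blockExt_blockExt]
    rw [e]
    exact hasDeg_comp_xorV (normP B a) (hy g)
  have h := card_win_blockExt_le_norm hcore B hm _ hn hD c y hy'
  have e : (univ.filter fun w : Fin m → Bool => ringWinU c y (blockExt B (blockExt B a (normP B a)) w) = true).card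
      = (univ.filter fun v : Fin m → Bool => ringWinU c y (blockExt B a v) = true).card := by
    have e1 : (univ.filter fun w : Fin m → Bool => ringWinU c y (blockExt B (blockExt B a (normP B a)) w) = true)
        = univ.filter fun w : Fin m → Bool => ringWinU c y (blockExt B a (xorV w (normP B a))) = true := by
      refine filter_congr fun w _ => ?_
      rw [blockExt_blockExt]
    rw [e1]
    exact card_filter_xorV (normP B a) (fun v => ringWinU c y (blockExt B a v) = true)
  rw [e] at h
  exact h

/-- **(c1) THE BLOCK-FIBRE LAW.** -/
theorem blockFibreLaw : BlockFibreLaw := by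
  obtain ⟨c₀, hc₀, m₀, hcore⟩ := failSet_ge_of_mem_fullSpan
  refine ⟨1 - c₀, by linarith, m₀, ?_⟩
  intro n m B hm a hadm D hD c y hy
  exact card_win_blockExt_le hcore B hm a hadm hD c y hy

end BlockFibre37

end Summit.QuantumAdvantage.AdviceFreeQNC0
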